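import Summits.ResolutionOfSingularities.ResolutionOfSingularities.Theorems.PurelyInseparableDim4DInfVirtualStep
import HarnessLib
import HarnessLib.Audit.Tags

/-!
# Purely inseparable four-folds — THE SUPPORT-CONFINED VIRTUAL STEP AT EVERY PRECISION, FOR EVERY PRIME `p` AND EVERY LETTER SET
# `S`: one real step of a constant-shade `e_G = 2` tail in the band `p < ord₀ < 2p` shadowed by ONE honest step of the virtual partner
# taken IN `S` (cell `res-dim4-pi`, K2(p) lane, slice C; the `S`-generic form of `…PairVirtualStep` (p708914, `S = {a, a′}`) of res-dim4-typ-1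
# g4's hN4-D design — serves the support-3 classes `(2,1,1)/(2,2,1)/(1,1,1)` of the `(p, d)` rungs after K2(5), which no pair covers)

[OURS · counted 0 · cell `res-dim4-pi` · K2(p) lane (holder res-dim4-p-12 g4) · seat res-dim4-typ-1 g4; the pair instance is
`…PairVirtualStep` (`SwapTransport.pairInv_refl` / `pair_virtual_step`, p708914), consumed by res-dim4-p-5 g5's general-p files.]
Nothing here proves hN4-D, TAIL-D, K2(p)/K2(5), `NoIsolatedTrap 5 5` or resolution of singularities in dimension ≥ 4 /
characteristic `p` — NOT proved.  AI kernel work, weaker than expert review.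

THE INVARIANT `INV_{p,S} A B π` (written out as a conjunction, in this order, in every statement below; `p` a prime, `S ⊆ Fin 4`): for a real state `A`, a
virtual state `B` and a letter bijection `π` (virtual ↦ real):
`B.r = A.r♯(π)` · `B.r` supported on `S` · `ord₀ B.F = ord₀ A.F` · `B.shade = A.shade` · `x^{B.r} ∣ B.F` · `B` isolated ·
`e_G(B) = 2` · TT_S: no non-zero `v ∈ resVertex B` vanishing on `S` · a COHERENT FRAME FAMILY `Θ : ℕ → frame`
(`Θ (M+1) ≡ Θ M mod 𝔪₀^{M+2}` letterwise) which at every precision `M` is origin-fixing, of slot form `Θ M (π i) = x_i · e M i`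
(unit) at every weighted letter `i`, has invertible tangent, and relates `B.F = clean_p(Uᵖ · Θ M (A.F)) + E`, `E ∈ 𝔪₀ᴹ`.
* **`supportInv_refl`** — ENTRY: a clean isolated state with `x^r ∣ F`, weights inside `S`, `e_G = 2` and TT_S is related to
  itself along `π = 1` (`Θ M = X`).  (TT for a PAIR `{a, a′} ⊆ S` — e.g. res-dim4-p-5 g5's `tt_of_satellite` — implies TT_S.)
* **`support_virtual_step`** — ONE STEP: from `INV_{p,S} A B π` and a real point step `A′ = step p univ jr b A` in the band
  (`p < ord₀ < 2p` on both sides, `x^r ∣ F` on both sides, shade kept, `A′` isolated with `e_G = 2`), there are a chart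
  `ℓ ∈ S`, a translation `β` (`β ℓ = 0`) and a bijection `π′` with `INV_{p,S} A′ (step p univ ℓ β B) π′`.  ROUTE: all `Θ M`
  have ONE tangent `N` (coherence); the real direction `d = e_jr + b` lies in `resVertex A` (shade kept,
  `direction_mem_resVertex_of_shade_eq`), so `v := N⁻¹ d ∈ resVertex B` (res-dim4-p-8 g5's `resVertex_eq_comap_of_slotUnit_rel_supp`)
  and TT_S gives a letter `ℓ ∈ S` with `v_ℓ ≠ 0` — the chart —, `β := v/v_ℓ − e_ℓ`; the children are related
  by the CANONICAL transport `transθ` (F1 `transport`) at every precision, coherently (F2 `transθ_congr`), with invertible tangent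
  (F2 `isUnit_det_transθ`), slot form reproduced on the newborn and the kept slots (F1), weights `B′.r = A′.r♯(π′)` by
  res-dim4-p-8's `step_r_apply_gen`, isolation / `ord₀` by F2 `read_of_rel`, `e_G` by res-dim4-p-8's
  `finrank_resVertex_eq_of_slotUnit_rel_supp`, TT by `resVertex_step_inf_hyperplane_le_resVertex`.
`S` is ANY letter set (for `|S| = 3` the fourth letter stays passive for ever; `S = {a, a′}` is `pair_virtual_step`), `p` ANY prime, the
order anything in the band `p < o < 2p`. [cite: CossartJannsenSaito2020, Thm. 3.10(4), Thm. 3.14] [cite: Hauser2010, §§F–G]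
bears_on: LADDER-RESOLUTION:D157-DOOR2 (res-dim4-pi · K2(p) slice C · support-confined virtual step, every prime).  Supports
stmt-ResolutionOfSingularities-16155 (helper).
-/

set_option linter.dupNamespace false -- mandated namespace of this single-conjunct summit

noncomputable section

namespace Summit.ResolutionOfSingularities.ResolutionOfSingularities.Theorems.PIDim4

namespace SwapTransport

open MvPolynomial Finset
open Literature.AlgebraicGeometry.Resolution
open Literature.AlgebraicGeometry.Resolution.CentreBlowup
open Literature.AlgebraicGeometry.Resolution.Hauser2010
open Literature.AlgebraicGeometry.Resolution.HauserPerlega2019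

variable {K : Type} [Field K]

/-! ## §1 The entry -/

/-- **ENTRY, every prime `p`, every letter set `S`**: a clean isolated state with `x^r ∣ F`, weights inside `S`, `e_G = 2` and TT_S
is INV-related to itself along `π = 1` with the constant frame family `Θ M = X`. [OURS] [folklore] -/
theorem supportInv_refl (p : ℕ) [Fact p.Prime] [CharP K p] [DecidableEq K] (S : Finset (Fin 4)) {A : State K}
    (hclean : deletePthPowers p A.F = A.F) (hrA : ∀ d ∈ A.F.support, A.r ≤ d) (hsupp : ∀ i, i ∉ S → A.r i = 0)
    (hiso : IsIsolated p A.F) (he : Module.finrank K (ResCone.resVertex A) = 2)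
    (hTT : ∀ v ∈ ResCone.resVertex A, (∀ i ∈ S, v i = 0) → v = 0) :
    A.r = Finsupp.mapDomain (1 : Equiv.Perm (Fin 4)).symm A.r ∧ (∀ i, i ∉ S → A.r i = 0) ∧
      ordZero A.F = ordZero A.F ∧ A.shade = A.shade ∧ (∀ d ∈ A.F.support, A.r ≤ d) ∧ IsIsolated p A.F ∧
      Module.finrank K (ResCone.resVertex A) = 2 ∧ (∀ v ∈ ResCone.resVertex A, (∀ i ∈ S, v i = 0) → v = 0) ∧
      ∃ (Θ e : ℕ → Fin 4 → MvPolynomial (Fin 4) K), (∀ M k, Θ (M + 1) k - Θ M k ∈ originIdeal K ^ (M + 2)) ∧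
        ∀ M, (∀ k, constantCoeff (Θ M k) = 0) ∧
          (∀ i, A.r i ≠ 0 → Θ M ((1 : Equiv.Perm (Fin 4)) i) = X i * e M i ∧ constantCoeff (e M i) ≠ 0) ∧
          IsUnit (Matrix.det (Matrix.of fun k m => coeff (Finsupp.single m 1) (Θ M k))) ∧
          ∃ U E : MvPolynomial (Fin 4) K, constantCoeff U ≠ 0 ∧ E ∈ originIdeal K ^ M ∧
            A.F = deletePthPowers p (U ^ p * aeval (Θ M) A.F) + E := by
  have htan : (Matrix.of fun k m => coeff (Finsupp.single m 1) ((X : Fin 4 → MvPolynomial (Fin 4) K) k)) = 1 := by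
    ext k m
    rw [Matrix.of_apply, coeff_X, Matrix.one_apply]
    by_cases h : k = m
    · rw [h, if_pos rfl, if_pos rfl]
    · rw [if_neg (fun h' => h ((Finsupp.single_left_inj one_ne_zero).mp h')), if_neg h]
  refine ⟨by ext i; rw [ResCone.mapDomain_symm_apply, Equiv.Perm.one_apply], hsupp, rfl, rfl, hrA, hiso, he, hTT,
    fun _ => X, fun _ _ => 1, fun M k => by rw [sub_self]; exact Submodule.zero_mem _, fun M => ⟨fun k => constantCoeff_X (R := K) k,
    fun i _ => ⟨by rw [Equiv.Perm.one_apply, mul_one], by rw [map_one]; exact one_ne_zero⟩, by rw [htan, Matrix.det_one]; exact isUnit_one,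
    1, 0, by rw [map_one]; exact one_ne_zero, Submodule.zero_mem _, ?_⟩⟩
  rw [one_pow, one_mul, add_zero, show aeval (X : Fin 4 → MvPolynomial (Fin 4) K) A.F = A.F from aeval_X_left_apply A.F, hclean]

/-! ## §2 THE VIRTUAL STEP -/

/-- **THE SUPPORT-CONFINED VIRTUAL STEP AT EVERY PRECISION, EVERY PRIME `p`, EVERY LETTER SET `S`** (statement and route in the
module docstring), for any orders in the band `p < o, o′ < 2p`. [OURS]
[cite: CossartJannsenSaito2020, Thm. 3.10(4), Thm. 3.14] [cite: Hauser2010, §§F–G] -/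
theorem support_virtual_step (p : ℕ) [Fact p.Prime] [CharP K p] [DecidableEq K] (S : Finset (Fin 4)) (A A' B : State K)
    (π : Equiv.Perm (Fin 4)) (jr : Fin 4) (b : Fin 4 → K) (hbj : b jr = 0) (hstep : A' = CentreBlowup.step p Finset.univ jr b A)
    (hdivA : ∀ d ∈ A.F.support, A.r ≤ d) (hdivA' : ∀ d ∈ A'.F.support, A'.r ≤ d)
    (hoA : ∃ o : ℕ, ordZero A.F = o ∧ p < o ∧ o < 2 * p) (hoA' : ∃ o' : ℕ, ordZero A'.F = o' ∧ p < o' ∧ o' < 2 * p)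
    (hshA : A'.shade = A.shade) (hisoA' : IsIsolated p A'.F) (heA' : Module.finrank K (ResCone.resVertex A') = 2)
    (hINV : B.r = Finsupp.mapDomain π.symm A.r ∧ (∀ i, i ∉ S → B.r i = 0) ∧
      ordZero B.F = ordZero A.F ∧ B.shade = A.shade ∧ (∀ d ∈ B.F.support, B.r ≤ d) ∧ IsIsolated p B.F ∧
      Module.finrank K (ResCone.resVertex B) = 2 ∧ (∀ v ∈ ResCone.resVertex B, (∀ i ∈ S, v i = 0) → v = 0) ∧
      ∃ (Θ e : ℕ → Fin 4 → MvPolynomial (Fin 4) K), (∀ M k, Θ (M + 1) k - Θ M k ∈ originIdeal K ^ (M + 2)) ∧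
        ∀ M, (∀ k, constantCoeff (Θ M k) = 0) ∧
          (∀ i, B.r i ≠ 0 → Θ M (π i) = X i * e M i ∧ constantCoeff (e M i) ≠ 0) ∧
          IsUnit (Matrix.det (Matrix.of fun k m => coeff (Finsupp.single m 1) (Θ M k))) ∧
          ∃ U E : MvPolynomial (Fin 4) K, constantCoeff U ≠ 0 ∧ E ∈ originIdeal K ^ M ∧
            B.F = deletePthPowers p (U ^ p * aeval (Θ M) A.F) + E) :
    ∃ (ℓ : Fin 4) (β : Fin 4 → K) (π' : Equiv.Perm (Fin 4)), ℓ ∈ S ∧ β ℓ = 0 ∧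
      ((CentreBlowup.step p Finset.univ ℓ β B).r = Finsupp.mapDomain π'.symm A'.r ∧
      (∀ i, i ∉ S → (CentreBlowup.step p Finset.univ ℓ β B).r i = 0) ∧
      ordZero (CentreBlowup.step p Finset.univ ℓ β B).F = ordZero A'.F ∧
      (CentreBlowup.step p Finset.univ ℓ β B).shade = A'.shade ∧
      (∀ d ∈ (CentreBlowup.step p Finset.univ ℓ β B).F.support, (CentreBlowup.step p Finset.univ ℓ β B).r ≤ d) ∧
      IsIsolated p (CentreBlowup.step p Finset.univ ℓ β B).F ∧
      Module.finrank K (ResCone.resVertex (CentreBlowup.step p Finset.univ ℓ β B)) = 2 ∧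
      (∀ v ∈ ResCone.resVertex (CentreBlowup.step p Finset.univ ℓ β B), (∀ i ∈ S, v i = 0) → v = 0) ∧
      ∃ (Θ' e' : ℕ → Fin 4 → MvPolynomial (Fin 4) K), (∀ M k, Θ' (M + 1) k - Θ' M k ∈ originIdeal K ^ (M + 2)) ∧
        ∀ M, (∀ k, constantCoeff (Θ' M k) = 0) ∧
          (∀ i, (CentreBlowup.step p Finset.univ ℓ β B).r i ≠ 0 →
            Θ' M (π' i) = X i * e' M i ∧ constantCoeff (e' M i) ≠ 0) ∧
          IsUnit (Matrix.det (Matrix.of fun k m => coeff (Finsupp.single m 1) (Θ' M k))) ∧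
          ∃ U E : MvPolynomial (Fin 4) K, constantCoeff U ≠ 0 ∧ E ∈ originIdeal K ^ M ∧
            (CentreBlowup.step p Finset.univ ℓ β B).F = deletePthPowers p (U ^ p * aeval (Θ' M) A'.F) + E) := by
  classical
  obtain ⟨o, hoA, h5o, ho10⟩ := hoA
  obtain ⟨o', hoA', h5o', ho10'⟩ := hoA'
  obtain ⟨hrB, hpairB, hoBA, hshBA, hdivB, hisoB, -, hTTB, Θ, e, hcoh, hΘ⟩ := hINV
  have hoB : ordZero B.F = o := by rw [hoBA, hoA]
  have hband : ∀ n : ℕ, p < n → n < 2 * p → ¬ p ∣ n := by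
    rintro n h1 h2 ⟨m, rfl⟩
    rcases Nat.lt_or_ge m 2 with hm | hm
    · interval_cases m <;> omega
    · exact absurd (Nat.mul_le_mul_left p hm) (by omega)
  have hpo : ¬ p ∣ o := hband o h5o ho10
  have hpo' : ¬ p ∣ o' := hband o' h5o' ho10'
  have h5A : ((p : ℕ) : ℕ∞) ≤ ordAlong Finset.univ A.F := by
    rw [ordAlong_univ, hoA]; exact_mod_cast h5o.le
  have h5B : ((p : ℕ) : ℕ∞) ≤ ordAlong Finset.univ B.F := by
    rw [ordAlong_univ, hoB]; exact_mod_cast h5o.le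
  -- (1) the common tangent `N`
  set N : Matrix (Fin 4) (Fin 4) K := Matrix.of fun k m => coeff (Finsupp.single m 1) (Θ 0 k) with hN
  have htan : ∀ M, (Matrix.of fun k m => coeff (Finsupp.single m 1) (Θ M k)) = N := fun M => by
    ext k m; rw [Matrix.of_apply, hN, Matrix.of_apply]; exact coeff_single_coherent hcoh M k m
  have hdet : ∀ M, IsUnit (Matrix.det (Matrix.of fun k m => coeff (Finsupp.single m 1) (Θ M k))) := fun M => (hΘ M).2.2.1
  have hdetN : IsUnit N.det := by rw [← htan 0]; exact hdet 0
  have hΘ0 : ∀ M k, constantCoeff (Θ M k) = 0 := fun M => (hΘ M).1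
  have hslot : ∀ M i, B.r i ≠ 0 → Θ M (π i) = X i * e M i ∧ constantCoeff (e M i) ≠ 0 := fun M => (hΘ M).2.1
  -- (2) the real direction lies in `resVertex A`
  have hshA' : (CentreBlowup.step p Finset.univ jr b A).shade = A.shade := by rw [← hstep]; exact hshA
  have hdA : PointBlowup.direction jr b ∈ ResCone.resVertex A :=
    ResCone.direction_mem_resVertex_of_shade_eq (q := p) jr hbj hoA hdivA h5o (by omega) hshA'
  have hdir_apply : ∀ k, PointBlowup.direction jr b k = b k + if k = jr then 1 else 0 := fun k => by
    by_cases hk : k = jr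
    · rw [hk, ResCone.direction_apply_self, hbj, zero_add, if_pos rfl]
    · rw [ResCone.direction_apply_of_ne hk, if_neg hk, add_zero]
  -- (3) `resVertex B = N⁻¹ (resVertex A)` (res-dim4-p-8 g5), at the precision `o + 1`
  have hVB : ResCone.resVertex B = (ResCone.resVertex A).comap (Matrix.toLin' N) := by
    obtain ⟨U, E, hU, hE, hrel⟩ := (hΘ (o + 1)).2.2.2
    have hθi : ∀ i, A.r (π i) ≠ 0 → Θ (o + 1) (π i) = X i * e (o + 1) i := fun i hi =>
      (hslot (o + 1) i (by rwa [hrB, ResCone.mapDomain_symm_apply])).1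
    have hei : ∀ i, A.r (π i) ≠ 0 → constantCoeff (e (o + 1) i) ≠ 0 := fun i hi =>
      (hslot (o + 1) i (by rwa [hrB, ResCone.mapDomain_symm_apply])).2
    rw [← htan (o + 1)]
    exact SwapNorm.resVertex_eq_comap_of_slotUnit_rel_supp p hθi hei (hΘ0 (o + 1)) hU hE hrel hoA hpo (by omega)
      (hdet (o + 1)) hdivA hrB
  -- (4) the virtual direction `v`, its chart `ℓ ∈ {a, a′}` and translation `β`
  obtain ⟨v, hv⟩ := exists_mulVec_eq hdetN (fun k => b k + if k = jr then 1 else 0)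
  have hvV : v ∈ ResCone.resVertex B := by
    rw [hVB, Submodule.mem_comap, Matrix.toLin'_apply, hv, show (fun k => b k + if k = jr then (1 : K) else 0) =
      PointBlowup.direction jr b from funext fun k => (hdir_apply k).symm]
    exact hdA
  have hvne : ¬ (∀ i ∈ S, v i = 0) := by
    intro hvS
    have hv0 := hTTB v hvV hvS
    have h := congrFun hv jr
    rw [hv0, Matrix.mulVec_zero, Pi.zero_apply, hbj, zero_add, if_pos rfl] at h
    exact zero_ne_one h
  obtain ⟨ℓ, hℓ, hvℓ⟩ : ∃ ℓ ∈ S, v ℓ ≠ 0 := by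
    by_contra h
    push Not at h
    exact hvne h
  set β : Fin 4 → K := fun m => if m = ℓ then 0 else v m / v ℓ with hβdef
  set lam : K := (v ℓ)⁻¹ with hlamdef
  have hNv : ∀ k, (Matrix.of fun k m => coeff (Finsupp.single m 1) (Θ 0 k)).mulVec v k = b k + if k = jr then 1 else 0 :=
    fun k => by rw [← hN, hv]
  obtain ⟨hβℓ, hlam, hdir0⟩ := dir_of_mulVec hNv hvℓ
  have hdir : ∀ M k, coeff (Finsupp.single ℓ 1) (Θ M k) +
      ∑ i ∈ Finset.univ.erase ℓ, coeff (Finsupp.single i 1) (Θ M k) * β i = lam * (b k + if k = jr then 1 else 0) := by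
    intro M k
    rw [← hdir0 k, coeff_single_coherent hcoh M k ℓ]
    exact congrArg _ (Finset.sum_congr rfl fun i _ => by rw [coeff_single_coherent hcoh M k i])
  -- (5) the direction correspondence at the slots: which slots are kept
  have hslot_row : ∀ i, B.r i ≠ 0 → i ≠ ℓ → constantCoeff (e 0 i) * β i = lam * (b (π i) + if π i = jr then 1 else 0) := by
    intro i hi hiℓ
    have h := hdir 0 (π i)
    obtain ⟨hθ, -⟩ := hslot 0 i hi
    simp_rw [coeff_single_slot hθ] at h
    rw [if_neg hiℓ.symm, zero_add] at h
    simp_rw [ite_mul, zero_mul] at h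
    rwa [Finset.sum_ite_eq' (Finset.univ.erase ℓ) i, if_pos (Finset.mem_erase.mpr ⟨hiℓ, Finset.mem_univ i⟩)] at h
  have hkeep : ∀ i, B.r i ≠ 0 → i ≠ ℓ → π i ≠ jr → (β i = 0 ↔ b (π i) = 0) := by
    intro i hi hiℓ hij
    have h := hslot_row i hi hiℓ
    rw [if_neg hij, add_zero] at h
    constructor
    · intro h0; rw [h0, mul_zero] at h; exact (mul_eq_zero.mp h.symm).resolve_left hlam
    · intro h0; rw [h0, mul_zero] at h; exact (mul_eq_zero.mp h).resolve_left (hslot 0 i hi).2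
  have hdrop : ∀ i, B.r i ≠ 0 → i ≠ ℓ → π i = jr → β i ≠ 0 := by
    intro i hi hiℓ hij h0
    have h := hslot_row i hi hiℓ
    rw [h0, mul_zero, hij, if_pos rfl, hbj, zero_add, mul_one] at h
    exact hlam h.symm
  have hℓrow : B.r ℓ ≠ 0 → π ℓ ≠ jr → b (π ℓ) ≠ 0 := by
    intro hl hlj hb0
    have h := hdir 0 (π ℓ)
    obtain ⟨hθ, hε⟩ := hslot 0 ℓ hl
    simp_rw [coeff_single_slot hθ] at h
    rw [if_true, if_neg hlj, hb0, add_zero, mul_zero] at h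
    simp_rw [ite_mul, zero_mul] at h
    rw [Finset.sum_ite_eq' (Finset.univ.erase ℓ) ℓ, if_neg (Finset.notMem_erase ℓ _), add_zero] at h
    exact hε h
  -- (6) the new bijection `π′ := π ∘ (ℓ g)`, `g := π⁻¹ jr`
  set g : Fin 4 := π.symm jr with hg
  have hπg : π g = jr := π.apply_symm_apply jr
  set π' : Equiv.Perm (Fin 4) := π * Equiv.swap ℓ g with hπ'
  have hπ'ℓ : π' ℓ = jr := by rw [hπ', Equiv.Perm.mul_apply, Equiv.swap_apply_left, hπg]
  have hπ'g : π' g = π ℓ := by rw [hπ', Equiv.Perm.mul_apply, Equiv.swap_apply_right]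
  have hπ'i : ∀ i, i ≠ ℓ → i ≠ g → π' i = π i := fun i hiℓ hig => by
    rw [hπ', Equiv.Perm.mul_apply, Equiv.swap_apply_of_ne_of_ne hiℓ hig]
  -- (7) the weights of the two children
  set B' : State K := CentreBlowup.step p Finset.univ ℓ β B with hB'
  have hrB'i : ∀ i, B'.r i = if i = ℓ then o - p else if β i = 0 then B.r i else 0 := fun i =>
    step_r_apply_gen p hoB ℓ β i
  have hrA'k : ∀ k, A'.r k = if k = jr then o - p else if b k = 0 then A.r k else 0 := fun k => by
    rw [hstep]; exact step_r_apply_gen p hoA jr b k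
  have hBrA : ∀ i, B.r i = A.r (π i) := fun i => by rw [hrB, ResCone.mapDomain_symm_apply]
  have hrB' : B'.r = Finsupp.mapDomain π'.symm A'.r := by
    ext m
    rw [ResCone.mapDomain_symm_apply, hrB'i, hrA'k]
    by_cases hmℓ : m = ℓ
    · rw [if_pos hmℓ, hmℓ, hπ'ℓ, if_pos rfl]
    rw [if_neg hmℓ]
    by_cases hmg : m = g
    · -- the preimage of the real chart letter: dropped (or weightless), and `π ℓ` is translated or weightless
      have hne : π ℓ ≠ jr := fun h => hmℓ (hmg.trans (π.injective (hπg.trans h.symm)))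
      have hlhs : (if β g = 0 then B.r g else 0) = 0 := by
        by_cases hBg : B.r g = 0
        · rw [hBg, ite_self]
        · rw [if_neg (hdrop g hBg (fun h => hmℓ (hmg.trans h)) hπg)]
      have hrhs : (if b (π ℓ) = 0 then A.r (π ℓ) else 0) = 0 := by
        by_cases hBl : B.r ℓ = 0
        · rw [← hBrA, hBl, ite_self]
        · rw [if_neg (hℓrow hBl hne)]
      rw [hmg, hπ'g, if_neg hne, hlhs, hrhs]
    · have hne : π m ≠ jr := fun h => hmg (π.injective (h.trans hπg.symm))
      rw [hπ'i m hmℓ hmg, if_neg hne, ← hBrA m]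
      by_cases hBm : B.r m = 0
      · rw [hBm, ite_self, ite_self]
      · by_cases hb : b (π m) = 0
        · rw [if_pos ((hkeep m hBm hmℓ hne).mpr hb), if_pos hb]
        · rw [if_neg (fun h0 => hb ((hkeep m hBm hmℓ hne).mp h0)), if_neg hb]
  have hpairB' : ∀ i, i ∉ S → B'.r i = 0 := fun i hiS => by
    have hiℓ : i ≠ ℓ := fun h => hiS (h ▸ hℓ)
    rw [hrB'i, if_neg hiℓ, hpairB i hiS, ite_self]
  have hdivB' : ∀ d ∈ B'.F.support, B'.r ≤ d := forall_le_step_gen B hdivB ℓ hβℓ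
  -- (8) the transported frame family
  obtain ⟨Nc, hcert⟩ := IsolationConverse.exists_certificate_of_isIsolated hisoA'
  set c : ℕ := Nc + 4 * p + 2 with hc
  set Θ' : ℕ → Fin 4 → MvPolynomial (Fin 4) K := fun M => transθ (Θ (M + c)) ℓ β jr b (M + c) with hΘ'
  set e' : ℕ → Fin 4 → MvPolynomial (Fin 4) K := fun M i => if i = ℓ then blowupFactor ℓ β (Θ (M + c) jr)
    else aeval (blowupSub ℓ β) (e (M + c) i) * invModPow (blowupFactor ℓ β (Θ (M + c) jr)) (M + c) with he'
  have hΘ'M : ∀ M, Θ' M = transθ (Θ (M + c)) ℓ β jr b (M + c) := fun M => rfl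
  have he'M : ∀ M i, e' M i = if i = ℓ then blowupFactor ℓ β (Θ (M + c) jr)
      else aeval (blowupSub ℓ β) (e (M + c) i) * invModPow (blowupFactor ℓ β (Θ (M + c) jr)) (M + c) := fun M i => rfl
  have hMc : ∀ M, 2 ≤ M + c := fun M => by omega
  have hframe : ∀ M, (∀ k, constantCoeff (Θ' M k) = 0) ∧
      (∀ i, B'.r i ≠ 0 → Θ' M (π' i) = X i * e' M i ∧ constantCoeff (e' M i) ≠ 0) ∧
      IsUnit (Matrix.det (Matrix.of fun k m => coeff (Finsupp.single m 1) (Θ' M k))) ∧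
      ∃ U E : MvPolynomial (Fin 4) K, constantCoeff U ≠ 0 ∧ E ∈ originIdeal K ^ (M + c - p) ∧
        B'.F = deletePthPowers p (U ^ p * aeval (Θ' M) A'.F) + E := by
    intro M
    obtain ⟨U, E, hU, hE, hrel⟩ := (hΘ (M + c)).2.2.2
    obtain ⟨h0, hU', E', hE', hrel'⟩ := transport p (hMc M) (hΘ0 (M + c)) hE hrel h5A h5B hβℓ hbj hlam (hdir (M + c))
    refine ⟨h0, fun i hi => ?_, isUnit_det_transθ (hΘ0 (M + c)) hβℓ hbj hlam (hdir (M + c)) (hMc M) (hdet (M + c)),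
      transU (Θ (M + c)) U ℓ β jr, E', by rw [hU']; exact mul_ne_zero hU hlam, hE', by rw [hB', hstep]; exact hrel'⟩
    by_cases hiℓ : i = ℓ
    · subst hiℓ
      obtain ⟨h1, h2⟩ := transθ_newborn (hΘ0 (M + c)) hbj (hdir (M + c)) (M + c)
      refine ⟨by rw [hπ'ℓ, hΘ'M, h1, he'M, if_pos rfl], by rw [he'M, if_pos rfl, h2]; exact hlam⟩
    · have hBi : B.r i ≠ 0 := by
        intro h0; rw [hrB'i, if_neg hiℓ, h0, ite_self] at hi; exact hi rfl
      have hβi : β i = 0 := by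
        by_contra hne; rw [hrB'i, if_neg hiℓ, if_neg hne] at hi; exact hi rfl
      obtain ⟨hθ, hε⟩ := hslot (M + c) i hBi
      obtain ⟨-, hkj, h3, h4, h5⟩ := transθ_kept (hΘ0 (M + c)) hbj hlam (hdir (M + c)) (hMc M) hθ hiℓ hβi
      have hig : i ≠ g := fun h => hkj (by rw [h, hπg])
      refine ⟨by rw [hπ'i i hiℓ hig, hΘ'M, h3, he'M, if_neg hiℓ], ?_⟩
      rw [he'M, if_neg hiℓ, h4]
      exact mul_ne_zero hε (left_ne_zero_of_mul_eq_one h5)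
  have hcoh' : ∀ M k, Θ' (M + 1) k - Θ' M k ∈ originIdeal K ^ (M + 2) := fun M k => by
    rw [hΘ'M, hΘ'M, show M + 1 + c = M + c + 1 by ring]
    exact transθ_congr (hΘ0 (M + c + 1)) (hΘ0 (M + c)) (n := M + 2) (m := M + c + 2) (by omega) (by omega) (hcoh (M + c))
      hbj hlam (hdir (M + c + 1)) (by omega) (hMc M) (by omega) (by omega) k
  -- (9) reading `ord₀` and isolation at the precision `c - p`
  obtain ⟨h00, hslot0, hdet0, U0, E0, hU0, hE0, hrel0⟩ := hframe 0
  rw [Nat.zero_add] at hE0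
  obtain ⟨hisoB', hoB'⟩ := read_of_rel p h00 hdet0 hU0 hE0 hrel0 hisoA' hcert (by omega) hoA' hpo' (by omega)
  have hrB'A : ∀ i, B'.r i = A'.r (π' i) := fun i => by rw [hrB', ResCone.mapDomain_symm_apply]
  have heB' : Module.finrank K (ResCone.resVertex B') = 2 := by
    rw [← heA']
    exact SwapNorm.finrank_resVertex_eq_of_slotUnit_rel_supp p (fun i hi => (hslot0 i (by rwa [hrB'A])).1)
      (fun i hi => (hslot0 i (by rwa [hrB'A])).2) h00 hU0 hE0 hrel0 hoA' hpo' (by omega) hdet0 hdivA' hrB'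
  have hdeg : B'.r.degree = A'.r.degree := by rw [hrB', degree_mapDomain_perm]
  have hdegB : B.r.degree = A.r.degree := by rw [hrB, degree_mapDomain_perm]
  have hshB'A : B'.shade = A'.shade := by
    show ordZero B'.F - (B'.r.degree : ℕ∞) = ordZero A'.F - (A'.r.degree : ℕ∞)
    rw [hoB', hoA', hdeg]
  have hshB'B : (CentreBlowup.step p Finset.univ ℓ β B).shade = B.shade := by rw [← hB', hshB'A, hshA, ← hshBA]
  have hTTB' : ∀ w ∈ ResCone.resVertex B', (∀ i ∈ S, w i = 0) → w = 0 := by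
    intro w hw hwS
    have hwℓ : w ℓ = 0 := hwS ℓ hℓ
    have h := ResCone.resVertex_step_inf_hyperplane_le_resVertex (q := p) ℓ hβℓ hoB hdivB h5o (by omega) hshB'B
      (Submodule.mem_inf.mpr ⟨hw, ResCone.mem_hyperplane.mpr hwℓ⟩)
    exact hTTB w (Submodule.mem_inf.mp h).1 hwS
  -- (10) assemble
  refine ⟨ℓ, β, π', hℓ, hβℓ, hrB', hpairB', by rw [hoB', hoA'], hshB'A, hdivB', hisoB', heB', hTTB', Θ', e', hcoh',
    fun M => ?_⟩
  obtain ⟨h0, hs, hd, U, E, hU, hE, hrel⟩ := hframe M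
  exact ⟨h0, hs, hd, U, E, hU, Ideal.pow_le_pow_right (by omega) hE, hrel⟩

end SwapTransport

end Summit.ResolutionOfSingularities.ResolutionOfSingularities.Theorems.PIDim4

end
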